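import Literature.NumberTheory.EllipticCurves.MatsunoCurvesRankDescentLemma53Proofs
import Literature.NumberTheory.EllipticCurves.MatsunoCurvesRankDescentProp54Proofs
import HarnessLib

/-!
# Matsuno 2009, Corollary 5.5 — discharged

`Proofs` companion of `Literature/NumberTheory/EllipticCurves/MatsunoCurvesRank.lean`: the named
fact `Literature.NumberTheory.EllipticCurves.Matsuno2009_cor55` (K. Matsuno, *Elliptic curves
with large Tate–Shafarevich groups over a number field*, Math. Res. Lett. **16** (2009),
449–461, **Corollary 5.5**, p. 457: `rank_ℤ A(K) ≤ 14n + 2h − 2`) HOLDS: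
`Matsuno2009_cor55_holds`.

The proof is the printed one ("By Lemma 5.3 and Proposition 5.4, we have
`dim_{𝔽₂} Sel₂(A/K) ≤ 14n + 2h`. The assertion follows from the exact sequence (1) and the fact
`dim_{𝔽₂} A(K)[2] = 2`"), run on the Mordell–Weil part `A(K)/2A(K) ↪ Sel₂(A/K)` through the
algebraic complete `2`-descent:

* `MatsunoCurvesRankDescent.lean` — the descent map `λ_K` on `A(K)`, `K_Σ = K⟮Σ_f, 2⟯²`, the span
  `L`, and the assembly `MatsunoParams.mordellWeilRank_le_of_lemma53_of_prop54`
  (`2^{rank+2} ≤ #λ_K(A(K))`, `#λ_K(A(K))·2^{4k} ≤ #K_Σ`);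
* `MatsunoCurvesRankDescentLemma53Proofs.lean` — **Lemma 5.3**: `#K⟮Σ_f, 2⟯ ≤ 2^{7n + 2k + h}`
  (`MatsunoParams.natCard_unitsModSq_le`: units modulo squares, `2`-torsion of the class
  group, `#Σ_f ≤ 6n + 2k`);
* `MatsunoCurvesRankDescentProp54Proofs.lean` — **Proposition 5.4** with `dim L = 4k` on
  `λ_K(A(K))` (`MatsunoParams.eq_zero_of_spanMap_mem_descentRange`: the local lemma at the
  inert primes `ℓᵢ`, `mⱼ`, parity of `ord`, quadratic residues and reciprocity).

## References

* [Matsuno2009] K. Matsuno, Math. Res. Lett. 16 (2009), 449–461, Lemma 5.3, Prop. 5.4,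
  Cor. 5.5 and its proof (p. 457).
-/

noncomputable section

open scoped Classical NumberField

namespace Literature.NumberTheory.EllipticCurves

/-- **Matsuno 2009, Corollary 5.5, PROVED** (p. 457): for a cyclic Galois extension `K/ℚ` of odd
degree `n`, Matsuno's parameters `P` (primes (A1)–(A4), `s, t` of Lemma 5.2) and any `h` such
that `Cl(𝓞_K)` contains no `(ℤ/2ℤ)^{h+1}`, the curve `A : y² + xy = x³ + 8m x² + lm x` of (5)
has `rank_ℤ A(K) ≤ 14n + 2h − 2`. (Only `[K : ℚ] = n` odd is used; the Galois and cyclicity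
hypotheses of the named fact are not needed for Corollary 5.5.) [cite: Matsuno2009, Corollary 5.5] -/
theorem Matsuno2009_cor55_holds : Matsuno2009_cor55 := by
  intro n hn K _ _ _ _ hK k P h hh
  exact P.mordellWeilRank_le_of_lemma53_of_prop54 (hK ▸ hn) h (P.natCard_unitsModSq_le hK hn hh)
    (P.eq_zero_of_spanMap_mem_descentRange hK hn)

end Literature.NumberTheory.EllipticCurves

end
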